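import Summits.QuantumFields.BalabanUV.T4Continuum.Support.B13CarriersCubeChart
import Summits.QuantumFields.BalabanUV.T4Continuum.Support.B13StepTermSocket
import Literature.MathematicalPhysics.QuantumFieldTheory.Balaban1983to89.T4HistoryLipschitzRescalingTorus

/-!
# U3 substrate — THE POLYMER DICTIONARY between the two readings of [II] (2.13) on Bałaban's carriers of record:
# NE9's cube-chart geometry `(B13CarriersCubeChart.cubeChart R).geom` and NE5's domain geometry
# `B13DomainGeometryTR.domainGeometry R` are ONE polymer system, and their localized cluster sums agree

Cell `pub-balaban`, SUBSTRATE cell seat `b2b-balaban-substrate-p2` ([dict] identification layer ∕ «the U3 one-step cluster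
representation typed ONCE for NE5 ∕ NE7 ∕ NE9», T4-DAG carver call Q-NE9-O1).  Summits-side bookkeeping under the LEAN PLACEMENT
RULE; nothing of the imported modules is edited, every tree object is used BY NAME.

HONEST FRAMING (T4-DAG p. 1).  Rung (B)+1 of the FINITE-VOLUME T⁴ continuum programme — NOT infinite volume, NOT a mass gap, NOT
the Clay problem, NOT a proof of NE5 or NE9 (neither is PRINTED in [Balaban1987RG1]–[Balaban1989LargeFieldII]).  HONEST DEPENDENCY
(cell line, verbatim): continuum YM on T⁴ ⇐ BetaPertH ∧ nine spine estimates (0/9 proved); BetaPertH ⇐ (D1) ∧ (D4) ∧ CAP+tail;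
G-an2-4 gates asym, D1 and NE2/3/4.  This file is a DICTIONARY: 0 estimate, no `def … : Prop` fact, nothing printed is asserted.

WHY THIS FILE.  Node U3 of the spine has ONE object — the one-step cluster representation of [Balaban1988RG2Cluster] §2,
`𝐄^{(k+1)}(X) = Σ_{n} (1/n!) Σ_{(Z_1,…,Z_n): ∪Z_i = X} ρ^T(Z_1,…,Z_n) H(Z_1)⋯H(Z_n)` ((2.13) p. 14) with the hard core
«ζ(Z, Z′) = 0 if Z ∩ Z′ contains a cube, or a wall of a cube» ((2.11) p. 14) — read by TWO rows on the SAME carriers of record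
`B13Carriers.TwoRuns.carriers` (p207668) through TWO polymer geometries between which the tree had no theorem:
* row NE9 (`Spine/NE9/CarriersOfRecordFaces`, END faces at `G := (B13CarriersCubeChart.cubeChart R).geom`): polymers =
  finite CUBE FAMILIES `Finset (SCube R)`, incompatibility `CubeInc (SAdj R)`, step volume `connFamilies (SAdj R) (region X)`,
  localizing families `CubeChart.clus X` (sub-families of the volume with union the footprint of `X`), new term
  `ClusterGeom.newTerm act k s U X Q = clusterSum … (act k s U Q) (clus X)`;
* row NE5 (route TR of record `B13StepOfRecord`, hard core `B13StepTermSocket.touchInc (domainGeometry R)`; route P2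
  `B13DomainGeometryTR.clusterRep R ρA ρB` with `DomainGeometry.inc`): polymers = the DOMAINS `R.carriers.Dom = Σ_j 𝐃_j`
  themselves, incompatibility = touching footprints, step volume `R.domAt k`, localizing families `coveringFamilies`.
So an activity family typed for one row did not serve the other.  THIS FILE proves they are ONE polymer system:
* §1 `isConn_of_map` (connectivity pulls back along an embedding), `footprint_injective`, `isConn_footprint`,
  **`mem_vol_cubeChart_iff`** ∕ **`vol_cubeChart_eq`**: NE9's step volume at `X` IS the image of NE5's catalogue `R.domAt X.1` under
  the embedded footprint (the two formalisations of «localization domain», pv22's `IsTDom` and the polymer crew's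
  `Polymer.IsConn`, agree: `T4HistoryLipschitzRescalingTorus.isTDom_iff_exists_isConn` BY NAME);
* §2 **`cubeInc_footprint_iff_touchInc`**, `inc_iff_touchInc` (the three hard cores agree on domains), **`clus_cubeChart_eq`**
  (NE9's localizing families = NE5's covering families, mapped);
* §3 **`clusterSum_cubeChart_eq`**: for EVERY activity `w` on cube families, NE9's localized cluster sum over `(cubeChart R).clus X`
  equals NE5's over `(domainGeometry R).clus X` at `w ∘ footprint` (relabelling invariance of the Kotecký–Preiss truncated
  functional, `ClusterExpansion.truncatedWeight_image` BY NAME), in both NE5 hard cores (`…_inc` for route P2's);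
* §4 **`newTerm_cubeChart_eq`** (NE9's `ClusterGeom.newTerm` on the geometry of record, rewritten as an NE5 cluster sum),
  **`outB_eq_newTerm`** ∕ `outA_eq_newTerm` (route P2's represented outputs ARE NE9 new terms for footprint-matched activities), and
  the READING FORM **`clusterSum_cubeChart_eq_of_reads`** ∕ **`newTerm_cubeChart_eq_of_reads`**: any cube-family activity that
  reads a domain activity on footprints has NE9's new term equal to NE5's (2.13) cluster sum — an activity family typed ONCE on
  the domains (NODE O's `act` slot of `B13StepOfRecord.Slots`, or route P2's `ρA ∕ ρB`) serves both rows; the canonical such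
  reading (the zero-extended LIFT `liftAct` ∕ `liftFam`, data) is the companion `Support/U3PolymerDictionaryLift`.
Value = wiring (no inequality): the rows' analytic leaves are untouched; spine PROVED 0∕9 unchanged.

References (TYPES ∕ locus only): T. Bałaban, *Renormalization group approach to lattice gauge field theories. II. Cluster
expansions*, Commun. Math. Phys. **116**, 1–22 (1988) [Balaban1988RG2Cluster] (2.11)–(2.13) p. 14; *I*, Commun. Math. Phys. **109**
(1987) [Balaban1987RG1] p. 257 (localization domains: «a union of a connected, finite family of cubes»); R. Kotecký, D. Preiss,
Commun. Math. Phys. **103** (1986) [KoteckyPreiss1986] (3) (the truncated functional).  The manuscripts under audit are cited for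
KIND only.
-/

noncomputable section

open scoped BigOperators

namespace Summit.QuantumFields.BalabanUV.T4Continuum.U3PolymerDictionary

open Literature.Probability.LatticeModels (truncatedWeight truncatedWeight_image)
open Literature.MathematicalPhysics.QuantumFieldTheory (Polymer.IsConn Polymer.Reach)
open Literature.MathematicalPhysics.QuantumFieldTheory.Balaban1983to89
open Literature.MathematicalPhysics.QuantumFieldTheory.Balaban1983to89.TreeLengthTorus (TPt TAdj TDom IsTDom)
open Literature.MathematicalPhysics.QuantumFieldTheory.Balaban1983to89.T4ActivityLipschitz (clusterSum ClusterRep)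
open Literature.MathematicalPhysics.QuantumFieldTheory.Balaban1983to89.T4HistoryLipschitzActivity (ClusterGeom)
open Literature.MathematicalPhysics.QuantumFieldTheory.Balaban1983to89.T4HistoryLipschitzCubeGeometry
  (CubeChart CubeInc connFamilies mem_connFamilies)
open Literature.MathematicalPhysics.QuantumFieldTheory.Balaban1983to89.T4HistoryLipschitzLinearSize (WallAdj)
open Literature.MathematicalPhysics.QuantumFieldTheory.Balaban1983to89.T4HistoryLipschitzRescaling (isConn_image)
open Literature.MathematicalPhysics.QuantumFieldTheory.Balaban1983to89.T4HistoryLipschitzRescalingTorus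
  (isTDom_iff_exists_isConn tAdj_iff_wallAdj)
open Summit.QuantumFields.BalabanUV.T4Continuum.B13Carriers (TwoRuns)
open Summit.QuantumFields.BalabanUV.T4Continuum.B13DomainGeometryTR
  (SCube SAdj sAdj_mk_iff fst_eq_of_sAdj embed embed_apply footprint mem_footprint footprint_nonempty
    fst_eq_of_mem_footprint touch domainGeometry)
open Summit.QuantumFields.BalabanUV.T4Continuum.B13CarriersCubeChart (cubeChart region mem_region_iff)
open Summit.QuantumFields.BalabanUV.T4Continuum.ClusterRepOfDomains (DomainGeometry)
open Summit.QuantumFields.BalabanUV.T4Continuum.B13StepTermSocket (touchInc)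

/-! ## §1 Connectivity along an embedding; NE9's step volume = the image of NE5's catalogue under the footprint -/

section Generic

variable {α β : Type*}

/-- [folklore] **Rooted connectivity pulls back along an embedding** whose images of adjacent points are adjacent in the
source sense: if `u.map e` is `adj'`-connected from `e a`, then `u` is `adj`-connected from `a`. -/
theorem isConn_of_map {adj : α → α → Prop} {adj' : β → β → Prop} (e : α ↪ β) {u : Finset α} {a : α}
    (hadj : ∀ x ∈ u, ∀ y ∈ u, adj' (e x) (e y) → adj x y) (h : Polymer.IsConn adj' (u.map e) (e a)) :
    Polymer.IsConn adj u a := by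
  have ha : a ∈ u := by simpa using h.1
  refine ⟨ha, fun b hb => ?_⟩
  -- every point reachable from `e a` inside `u.map e` is the image of a point reachable from `a` inside `u`
  have key : ∀ c, Polymer.Reach adj' (u.map e) (e a) c → ∀ y ∈ u, c = e y → Polymer.Reach adj u a y := by
    intro c hc
    induction hc with
    | refl =>
      intro y _ hy
      rw [e.injective hy]
      exact Polymer.Reach.refl _
    | @tail v w _ hvw ih =>
      intro y hy hwy
      obtain ⟨hv, -, hadj'⟩ := hvw
      obtain ⟨x, hx, rfl⟩ := Finset.mem_map.1 hv
      subst hwy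
      exact Polymer.Reach.tail (ih x hx rfl) hx hy (hadj x hx y hy hadj')
  exact key (e b) (h.2 (e b) (Finset.mem_map_of_mem e hb)) b hb rfl

end Generic

variable {G : Type} [GaugeGroup G] {R : TwoRuns G}

/-- [folklore] The embedded footprint DETERMINES the domain (its scale is the scale of any of its cubes, and `embed` is injective). -/
theorem footprint_injective : Function.Injective (footprint : R.carriers.Dom → Finset (SCube R)) := by
  rintro ⟨j, Y⟩ ⟨j', Y'⟩ h
  obtain ⟨c, hc⟩ := footprint_nonempty (⟨j, Y⟩ : R.carriers.Dom)
  have hj : j = j' := by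
    have h1 := fst_eq_of_mem_footprint hc
    rw [h] at hc
    have h2 := fst_eq_of_mem_footprint hc
    exact h1.symm.trans h2
  subst hj
  have hY : Y.1 = Y'.1 := Finset.map_injective (embed R j) h
  rw [Subtype.ext hY]

/-- [folklore] `K ↦ K.image footprint` is injective on families of domains. -/
theorem image_footprint_injective :
    Function.Injective (fun K : Finset R.carriers.Dom => K.image (footprint (R := R))) :=
  Finset.image_injective footprint_injective

/-- [folklore] The footprint of `⟨j, Y⟩` is the image of `Y` under `embed j`. -/
theorem footprint_eq_image (X : R.carriers.Dom) : footprint X = X.2.1.image (embed R X.1) := by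
  rw [footprint, Finset.map_eq_image]

/-- [folklore] **A domain's footprint is a connected cube family** for the fibrewise wall adjacency `SAdj` (pv22's `IsTDom` ⇒
`Polymer.IsConn WallAdj` by `isTDom_iff_exists_isConn`, transported along `embed` by `isConn_image` with `tAdj_iff_wallAdj`). -/
theorem isConn_footprint (X : R.carriers.Dom) : ∃ a ∈ footprint X, Polymer.IsConn (SAdj R) (footprint X) a := by
  obtain ⟨j, Y⟩ := X
  obtain ⟨q, hq⟩ := isTDom_iff_exists_isConn.1 Y.2
  refine ⟨embed R j q, ?_, ?_⟩
  · exact Finset.mem_map_of_mem _ hq.1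
  · rw [footprint_eq_image]
    exact isConn_image (embed R j)
      (fun x _ y _ hxy => Or.inr (sAdj_mk_iff.2 (tAdj_iff_wallAdj.2 hxy))) hq

/-- [folklore] Conversely, **a connected cube family of one scale is the footprint of a domain of that scale**. -/
theorem exists_footprint_eq_of_isConn {j : ℕ} {u : Finset (TPt 4 (R.cubesPerDir j))} {q : TPt 4 (R.cubesPerDir j)}
    (h : Polymer.IsConn (SAdj R) (u.map (embed R j)) (embed R j q)) :
    ∃ Y : TDom 4 (R.cubesPerDir j), footprint (⟨j, Y⟩ : R.carriers.Dom) = u.map (embed R j) := by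
  have hu : Polymer.IsConn WallAdj u q :=
    isConn_of_map (embed R j) (fun x _ y _ hxy => tAdj_iff_wallAdj.1 (sAdj_mk_iff.1 hxy)) h
  exact ⟨⟨u, isTDom_iff_exists_isConn.2 ⟨q, hu⟩⟩, rfl⟩

/-- [folklore] **NE9's STEP VOLUME READ IN NE5's CATALOGUE**: a cube family lies in `(cubeChart R).vol X` (connected families of
the region of `X`) iff it is the footprint of a domain of the scale of `X`. -/
theorem mem_vol_cubeChart_iff {X : R.carriers.Dom} {F : Finset (SCube R)} :
    F ∈ (cubeChart R).vol X ↔ ∃ Z ∈ R.domAt X.1, footprint Z = F := by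
  rw [CubeChart.vol, mem_connFamilies]
  constructor
  · rintro ⟨hsub, a, ha, hconn⟩
    -- `F` lies in one fibre, hence is `u.map (embed X.1)`
    have hsub' : F ⊆ (Finset.univ : Finset (TPt 4 (R.cubesPerDir X.1))).map (embed R X.1) := hsub
    obtain ⟨u, -, rfl⟩ := Finset.subset_map_iff.1 hsub'
    obtain ⟨q, -, rfl⟩ := Finset.mem_map.1 ha
    obtain ⟨Y, hY⟩ := exists_footprint_eq_of_isConn hconn
    exact ⟨⟨X.1, Y⟩, R.mem_domAt.2 rfl, hY⟩
  · rintro ⟨Z, hZ, rfl⟩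
    have hZ1 : Z.1 = X.1 := R.mem_domAt.1 hZ
    refine ⟨fun c hc => mem_region_iff.2 ((fst_eq_of_mem_footprint hc).trans hZ1), ?_⟩
    obtain ⟨a, ha, hconn⟩ := isConn_footprint Z
    exact ⟨a, ha, hconn⟩

/-- [folklore] **NE9's step volume IS the image of NE5's catalogue `𝐃_{scale X}` under the embedded footprint.** -/
theorem vol_cubeChart_eq (X : R.carriers.Dom) : (cubeChart R).vol X = (R.domAt X.1).image footprint := by
  ext F
  rw [mem_vol_cubeChart_iff, Finset.mem_image]

/-! ## §2 The hard cores agree; NE9's localizing families are NE5's covering families -/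

/-- [folklore] The TR hard core of record, unfolded: footprints touch. -/
theorem touchInc_iff (Z Z' : R.carriers.Dom) :
    touchInc (domainGeometry R) Z Z' ↔ touch (footprint Z) (footprint Z') := Iff.rfl

/-- [folklore] **NE9's `CubeInc` on footprints IS NE5's hard core of record `touchInc`** ((2.11)'s ζ = 0 in both readings). -/
theorem cubeInc_footprint_iff_touchInc (Z Z' : R.carriers.Dom) :
    CubeInc (SAdj R) (footprint Z) (footprint Z') ↔ touchInc (domainGeometry R) Z Z' := by
  rw [touchInc_iff]
  constructor
  · rintro (h | ⟨c, hc, c', hc', h⟩)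
    · obtain ⟨a, ha⟩ := footprint_nonempty Z
      exact ⟨a, ha, a, h ▸ ha, Or.inl rfl⟩
    · exact ⟨c, hc, c', hc', h⟩
  · rintro ⟨c, hc, c', hc', h⟩
    exact Or.inr ⟨c, hc, c', hc', h⟩

/-- [folklore] Touching footprints have equal scales. -/
theorem fst_eq_of_touchInc {Z Z' : R.carriers.Dom} (h : touchInc (domainGeometry R) Z Z') : Z.1 = Z'.1 := by
  obtain ⟨c, hc, c', hc', h⟩ := (touchInc_iff Z Z').1 h
  have h1 := fst_eq_of_mem_footprint hc
  have h2 := fst_eq_of_mem_footprint hc'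
  rcases h with rfl | h
  · exact h1.symm.trans h2
  · exact h1.symm.trans ((fst_eq_of_sAdj h).trans h2)

/-- [folklore] **Route P2's hard core `DomainGeometry.inc` IS the TR hard core `touchInc`** (the scale clause is automatic). -/
theorem inc_iff_touchInc (Z Z' : R.carriers.Dom) : (domainGeometry R).inc Z Z' ↔ touchInc (domainGeometry R) Z Z' :=
  ⟨fun h => h.2, fun h => ⟨fst_eq_of_touchInc h, h⟩⟩

/-- [folklore] Mapping a family of domains to footprints and taking the union gives the union of the footprints. -/
theorem biUnion_image_footprint (K : Finset R.carriers.Dom) :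
    (K.image footprint).biUnion id = K.biUnion footprint := by
  ext c
  simp only [Finset.mem_biUnion, Finset.mem_image, id_eq]
  constructor
  · rintro ⟨F, ⟨Z, hZ, rfl⟩, hc⟩
    exact ⟨Z, hZ, hc⟩
  · rintro ⟨Z, hZ, hc⟩
    exact ⟨footprint Z, ⟨Z, hZ, rfl⟩, hc⟩

/-- [folklore] A sub-family of an image family is the image of a sub-family (finite-set bookkeeping). -/
theorem exists_eq_image_of_subset_image {K' : Finset (Finset (SCube R))} {D : Finset R.carriers.Dom}
    (h : K' ⊆ D.image footprint) : ∃ K ⊆ D, K.image footprint = K' := by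
  classical
  refine ⟨D.filter fun Z => footprint Z ∈ K', Finset.filter_subset _ _, ?_⟩
  ext F
  simp only [Finset.mem_image, Finset.mem_filter]
  constructor
  · rintro ⟨Z, ⟨-, hZ⟩, rfl⟩
    exact hZ
  · intro hF
    obtain ⟨Z, hZ, rfl⟩ := Finset.mem_image.1 (h hF)
    exact ⟨Z, ⟨hZ, hF⟩, rfl⟩

/-- [folklore] Membership in NE5's covering families of `X` (route P2 ∕ TR: sub-families of `𝐃_{scale X}` whose footprints cover
the footprint of `X` exactly). -/
theorem mem_clus_domainGeometry_iff {X : R.carriers.Dom} {K : Finset R.carriers.Dom} :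
    K ∈ (domainGeometry R).clus X ↔ K ⊆ R.domAt X.1 ∧ K.biUnion footprint = footprint X :=
  (domainGeometry R).mem_clus

/-- [folklore] **NE9's LOCALIZING FAMILIES ARE NE5's COVERING FAMILIES** ((2.13)'s index set «(Z_1,…,Z_n): ∪Z_i = X» in both
readings): `(cubeChart R).clus X` is the image of `(domainGeometry R).clus X` under `K ↦ K.map footprint`. -/
theorem mem_clus_cubeChart_iff {X : R.carriers.Dom} {K' : Finset (Finset (SCube R))} :
    K' ∈ (cubeChart R).clus X ↔ ∃ K ∈ (domainGeometry R).clus X, K.image footprint = K' := by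
  rw [CubeChart.mem_clus, vol_cubeChart_eq]
  constructor
  · rintro ⟨hsub, hU⟩
    obtain ⟨K, hK, rfl⟩ := exists_eq_image_of_subset_image hsub
    refine ⟨K, mem_clus_domainGeometry_iff.2 ⟨hK, ?_⟩, rfl⟩
    rw [← biUnion_image_footprint, hU]
    rfl
  · rintro ⟨K, hK, rfl⟩
    obtain ⟨hK, hU⟩ := mem_clus_domainGeometry_iff.1 hK
    refine ⟨Finset.image_subset_image hK, ?_⟩
    rw [biUnion_image_footprint, hU]
    rfl

/-- [folklore] The same, as an equation of finite sets. -/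
theorem clus_cubeChart_eq (X : R.carriers.Dom) :
    (cubeChart R).clus X = ((domainGeometry R).clus X).image (fun K => K.image footprint) := by
  ext K'
  rw [mem_clus_cubeChart_iff, Finset.mem_image]

/-! ## §3 The localized cluster sums agree -/

/-- [folklore] **RELABELLING ONE FAMILY**: the truncated functional of a family of domains, read on its footprints with NE9's
hard core, equals the truncated functional read on the domains with NE5's hard core of record (`truncatedWeight_image`). -/
theorem truncatedWeight_image_footprint (w : Finset (SCube R) → ℂ) (K : Finset R.carriers.Dom) :
    truncatedWeight (CubeInc (SAdj R)) w (K.image footprint) =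
      truncatedWeight (touchInc (domainGeometry R)) (fun Z => w (footprint Z)) K :=
  truncatedWeight_image (footprint_injective.injOn) (fun a _ b _ => cubeInc_footprint_iff_touchInc a b)
    (fun _ _ => rfl)

/-- [folklore] Route P2's hard core and the TR hard core give the same truncated functionals. -/
theorem truncatedWeight_inc_eq_touchInc (ρ : R.carriers.Dom → ℂ) (K : Finset R.carriers.Dom) :
    truncatedWeight (domainGeometry R).inc ρ K = truncatedWeight (touchInc (domainGeometry R)) ρ K := by
  have h := truncatedWeight_image (inc := (domainGeometry R).inc) (inc' := touchInc (domainGeometry R)) (φ := id)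
    (w := ρ) (w' := ρ) (C := K) (Set.injOn_id _) (fun a _ b _ => (inc_iff_touchInc a b).symm) (fun _ _ => rfl)
  rw [Finset.image_id] at h
  exact h.symm

/-- [folklore] **THE (2.13) LOCALIZED CLUSTER SUMS AGREE** — for every activity `w` on cube families, NE9's sum over
`(cubeChart R).clus X` with hard core `CubeInc (SAdj R)` equals NE5's sum over `(domainGeometry R).clus X` with the hard core
of record `touchInc`, at the activity `w ∘ footprint`. -/
theorem clusterSum_cubeChart_eq (w : Finset (SCube R) → ℂ) (X : R.carriers.Dom) :
    clusterSum (CubeInc (SAdj R)) w ((cubeChart R).clus X) =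
      clusterSum (touchInc (domainGeometry R)) (fun Z => w (footprint Z)) ((domainGeometry R).clus X) := by
  unfold clusterSum
  rw [clus_cubeChart_eq, Finset.sum_image fun K _ K' _ h => image_footprint_injective h]
  exact Finset.sum_congr rfl fun K _ => truncatedWeight_image_footprint w K

/-- [folklore] The same with route P2's hard core `DomainGeometry.inc` on the NE5 side. -/
theorem clusterSum_cubeChart_eq_inc (w : Finset (SCube R) → ℂ) (X : R.carriers.Dom) :
    clusterSum (CubeInc (SAdj R)) w ((cubeChart R).clus X) =
      clusterSum (domainGeometry R).inc (fun Z => w (footprint Z)) ((domainGeometry R).clus X) := by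
  rw [clusterSum_cubeChart_eq]
  unfold clusterSum
  exact Finset.sum_congr rfl fun K _ => (truncatedWeight_inc_eq_touchInc _ K).symm

/-! ## §4 NE9's new term ↔ NE5's represented outputs; the lift of a domain activity -/

/-- [folklore] **NE9's NEW TERM ON THE GEOMETRY OF RECORD, READ IN NE5's POLYMERS**: `ClusterGeom.newTerm` at
`(cubeChart R).geom` is the NE5 cluster sum (hard core of record) of the footprint-read activities. -/
theorem newTerm_cubeChart_eq {Bg : Type} {Pot : Type*} (act : ℕ → ℝ → Bg → Pot → Finset (SCube R) → ℂ)
    (k : ℕ) (s : ℝ) (U : Bg) (X : R.carriers.Dom) (Q : Pot) :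
    (cubeChart R).geom.newTerm act k s U X Q =
      clusterSum (touchInc (domainGeometry R)) (fun Z => act k s U Q (footprint Z)) ((domainGeometry R).clus X) := by
  rw [ClusterGeom.newTerm, ← clusterSum_cubeChart_eq]
  rfl

/-- [folklore] **ROUTE P2's RUN-B OUTPUT IS AN NE9 NEW TERM**: if run B's activity family at `(g, U)` is the footprint reading of
an NE9 activity at `(k, s, U′, Q)`, then `(clusterRep R ρA ρB).outB g U X = newTerm act k s U′ X Q`. -/
theorem outB_eq_newTerm (ρA ρB : (ℕ → ℝ) → R.carriers.BgB → R.carriers.Dom → ℂ) {Bg : Type} {Pot : Type*}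
    (act : ℕ → ℝ → Bg → Pot → Finset (SCube R) → ℂ) {g : ℕ → ℝ} {U : R.carriers.BgB} {k : ℕ} {s : ℝ} {U' : Bg}
    {Q : Pot} {X : R.carriers.Dom} (h : ∀ Z ∈ R.domAt X.1, ρB g U Z = act k s U' Q (footprint Z)) :
    (B13DomainGeometryTR.clusterRep R ρA ρB).outB g U X = (cubeChart R).geom.newTerm act k s U' X Q := by
  rw [newTerm_cubeChart_eq, ClusterRep.outB]
  show clusterSum (domainGeometry R).inc (ρB g U) ((domainGeometry R).clus X) = _
  unfold clusterSum
  refine Finset.sum_congr rfl fun K hK => ?_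
  rw [truncatedWeight_inc_eq_touchInc]
  exact Literature.Probability.LatticeModels.truncatedWeight_congr fun Z hZ =>
    h Z ((mem_clus_domainGeometry_iff.1 hK).1 hZ)

/-- [folklore] The run-A twin of `outB_eq_newTerm`. -/
theorem outA_eq_newTerm (ρA ρB : (ℕ → ℝ) → R.carriers.BgB → R.carriers.Dom → ℂ) {Bg : Type} {Pot : Type*}
    (act : ℕ → ℝ → Bg → Pot → Finset (SCube R) → ℂ) {g : ℕ → ℝ} {U : R.carriers.BgB} {k : ℕ} {s : ℝ} {U' : Bg}
    {Q : Pot} {X : R.carriers.Dom} (h : ∀ Z ∈ R.domAt X.1, ρA g U Z = act k s U' Q (footprint Z)) :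
    (B13DomainGeometryTR.clusterRep R ρA ρB).outA g U X = (cubeChart R).geom.newTerm act k s U' X Q := by
  rw [newTerm_cubeChart_eq, ClusterRep.outA]
  show clusterSum (domainGeometry R).inc (ρA g U) ((domainGeometry R).clus X) = _
  unfold clusterSum
  refine Finset.sum_congr rfl fun K hK => ?_
  rw [truncatedWeight_inc_eq_touchInc]
  exact Literature.Probability.LatticeModels.truncatedWeight_congr fun Z hZ =>
    h Z ((mem_clus_domainGeometry_iff.1 hK).1 hZ)

/-- [folklore] **ONE ACTIVITY INSTANCE SERVES BOTH ROWS** (reading form): any cube-family activity `w` that READS a domain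
activity `ρ` on footprints has NE9's localized cluster sum equal to NE5's cluster sum of `ρ` (hard core of record); the
companion `U3PolymerDictionaryLift.liftAct` is such a `w` for every `ρ`. -/
theorem clusterSum_cubeChart_eq_of_reads {w : Finset (SCube R) → ℂ} {ρ : R.carriers.Dom → ℂ}
    (h : ∀ Z, w (footprint Z) = ρ Z) (X : R.carriers.Dom) :
    clusterSum (CubeInc (SAdj R)) w ((cubeChart R).clus X) =
      clusterSum (touchInc (domainGeometry R)) ρ ((domainGeometry R).clus X) := by
  rw [clusterSum_cubeChart_eq]
  simp only [h]

/-- [folklore] **NE9's NEW TERM OF A FAMILY READING A DOMAIN FAMILY** is NE5's (2.13) cluster sum of that family. -/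
theorem newTerm_cubeChart_eq_of_reads {Bg : Type} {Pot : Type*} {act : ℕ → ℝ → Bg → Pot → Finset (SCube R) → ℂ}
    {act₅ : ℕ → ℝ → Bg → Pot → R.carriers.Dom → ℂ} (h : ∀ k s U Q Z, act k s U Q (footprint Z) = act₅ k s U Q Z)
    (k : ℕ) (s : ℝ) (U : Bg) (X : R.carriers.Dom) (Q : Pot) :
    (cubeChart R).geom.newTerm act k s U X Q =
      clusterSum (touchInc (domainGeometry R)) (act₅ k s U Q) ((domainGeometry R).clus X) := by
  rw [newTerm_cubeChart_eq]
  simp only [h]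

end Summit.QuantumFields.BalabanUV.T4Continuum.U3PolymerDictionary

end
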